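import Literature.Analysis.FluidPDE.AnomalousDissipation
import Literature.Analysis.FluidPDE.CheskidovTotalDissipationProofs
import Literature.Analysis.FluidPDE.CheskidovNoAnomalyEstimates
import Literature.Analysis.FluidPDE.CheskidovNoAnomalyLift
import Literature.Analysis.FluidPDE.PassiveScalarWellPosednessProofs
import Literature.Analysis.FluidPDE.QuasiSelfSimilarFamilyProofs
import Literature.Analysis.FluidPDE.QuasiSelfSimilarCompatibleBlocksProofs
import Literature.Analysis.FunctionSpaces.TorusClassicalNSGluing
import HarnessLib

/-!
# Bruè–De Lellis' anomalous dissipation theorem from the Alberti–Crippa–Mazzucato blocks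
(CMP 400 (2023), Thm. 1.1 from Thm. 4.1)

Topic `Literature/Analysis/FluidPDE` (family `turb`, statement **turb.S10**). Theorem-only assembly
file for the vendored named fact `Literature.Analysis.FluidPDE.brue_deLellis_anomalous_dissipation`
(`AnomalousDissipation.lean`; E. Bruè, C. De Lellis, *Anomalous dissipation for the forced 3D
Navier–Stokes equations*, Comm. Math. Phys. 400 (2023) = arXiv:2207.06301, Thm. 1.1): viscosities
`ν_m ↓ 0`, one smooth datum, smooth forces uniformly bounded in `C([0,1]; C^α(T³))` for every
`α < 1`, smooth solutions of forced Navier–Stokes on `[0,1] × T³` with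
`liminf_m ν_m ∫₀¹ ‖∇u_m‖²_{L²} > 0`.

The printed proof (source, §3 "Strategy", Thm. 3.1; §4 Thm. 4.1; §5) has two inputs:

1. the quasi-self-similar mixing family of Alberti–Crippa–Mazzucato (source, Thm. 4.1 =
   Cheskidov, arXiv:2311.04182, Thm. 3.1) — the named fact
   `Literature.Analysis.FluidPDE.alberti_crippa_mazzucato_family` (`QuasiSelfSimilarMixing.lean`,
   item (c) per level), NOT discharged, but proved in the tree from the structural fact
   `acm_building_blocks` (`QuasiSelfSimilarBuildingBlocks.lean`) by
   `alberti_crippa_mazzucato_family_of_building_blocks`, itself proved from the kinematic leaf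
   `acm_compatible_blocks` (`QuasiSelfSimilarCompatibleBlocks.lean`) by
   `acm_building_blocks_of_compatible_blocks`;
2. classical parabolic well-posedness of the advection–diffusion equation on `T²` (source, §3.2,
   "We then solve the advection diffusion equation (3.12)") — DISCHARGED,
   `Torus.exists_unique_isClassicalScalarTransportForcedOn_holds` (`PassiveScalarWellPosednessProofs`).

Everything in between is proved here or reused from the landed Cheskidov cluster, which formalises
the same `2½`-dimensional construction (source, §3.1 (2½D-NS), §5 (5.1)–(5.4); Cheskidov 2023,
§§3–4): the glued drifts `v^m = Gluing.drift v m` and their Navier–Stokes forces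
`g^m = ∂ₜv^m + (v^m·∇)v^m - ν_mΔv^m` (`CheskidovGluedFamily`, `CheskidovForces`), the viscous
scalars `θ^m` on `[0,2]` with Cheskidov's viscosities `ν_m = (m+1)^{7/4}λ_m⁻²`, `λ_m = 5^m`
(`Cheskidov2023.visc`) and the **total dissipation** `‖θ^m(1)‖_{L²} → 0`, i.e.
`2ν_m ∫₀¹ ‖∇θ^m‖² → 1` (the argument of `CheskidovTotalDissipationProofs`: closeness (4.3),
`CheskidovScalarEstimates`, and the heat phase (4.6)–(4.12), `CheskidovHeatPhase`) — which is
MORE than the `liminf > 0` of (1.3) — and the `2½`-dimensional Navier–Stokes solutions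
`u^m = (v^m, θ^m) ∘ π` with force `f^m = (g^m, 0) ∘ π` (`TwoHalfNavierStokes`,
`CheskidovNoAnomalyLift`). What this file adds to reach the clauses of turb.S10:

* `BrueDeLellis2023.strictAnti_visc` — `ν_m` is strictly decreasing (the statement asks for
  `StrictAnti`);
* `BrueDeLellis2023.eBoundedHolderNorm_viscous_le_sharp`, `BrueDeLellis2023.tendsto_viscHolderErr`,
  `BrueDeLellis2023.exists_forall_eBoundedHolderNorm_nsBodyForce_le` — the uniform bound
  `sup_{m,t} ‖g^m(t)‖_{C^{0,α}(T²)} < ∞` for every `α < 1` (source, Lemma 5.1 and (5.4): on the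
  moving block the Euler force is `O(poly(n) λ_n^{α-1})` in `C^α`, `Gluing.blockForce_bounds`; the
  viscous term `ν_mΔv^m` is `O(ν_m poly(m) λ_m^{1+α}) = O(poly(m) λ_m^{α-1})` — this needs the sharp
  interpolated form, the landed `Gluing.eBoundedHolderNorm_viscous_le` being deliberately crude);
* `BrueDeLellis2023.continuousInHolderOn_of_isSmoothSpaceTimeOn` — jointly smooth fields on
  `[a,b] × T^d` are continuous in time with values in `C^{0,r}`, `r < 1` (tube lemma plus
  interpolation; the continuity half of `C([0,1]; C^α)` in (1.2));
* the assembly `brue_deLellis_anomalous_dissipation_of_blocks` and its corollaries down to the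
  kinematic leaf: `_of_acm_family`, `_of_acm`, `_of_acm_building_blocks`, `_of_compatible_blocks`.

What remains for `brue_deLellis_anomalous_dissipation_holds` is exactly `acm_compatible_blocks_holds`
(ACM 2019, §8.1 (a)–(e): the two generating moves of the Peano snake).

No named fact is introduced (D-0026): this file contains theorems only.

## References

* E. Bruè, C. De Lellis, *Anomalous dissipation for the forced 3D Navier–Stokes equations*,
  Comm. Math. Phys. 400 (2023) (arXiv:2207.06301): Thm. 1.1 with (1.2)–(1.3) (p. 2), §3 Thm. 3.1
  and (2½D-NS) (pp. 5–6), Thm. 4.1 and (4.3) (pp. 7–8), §5 (5.1)–(5.4), Lemma 5.1.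
* A. Cheskidov, *Dissipation anomaly and anomalous dissipation in incompressible fluid flows*,
  arXiv:2311.04182 (2023), Thm. 3.1, §3 (3.4)–(3.13), §4 (4.2)–(4.13).
* G. Alberti, G. Crippa, A. L. Mazzucato, *Exponential self-similar mixing by incompressible
  flows*, J. Amer. Math. Soc. 32 (2019), §8.
-/

noncomputable section

open MeasureTheory Set Filter
open _root_.Topology
open scoped ENNReal NNReal InnerProductSpace

namespace Literature.Analysis.FluidPDE

namespace BrueDeLellis2023

open Gluing Literature.Analysis.FunctionSpaces
open Literature.Analysis.FunctionSpaces.Torus (twoHalf planarProj)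

/-! ## The viscosities `ν_m = (m+1)^{7/4} λ_m⁻²` are strictly decreasing -/

/-- `ν_{m+1} < ν_m` for Cheskidov's viscosities `ν_m = (m+1)^{7/4}/25^m`
(`((m+2)/(m+1))^{7/4} ≤ 2^{7/4} < 25`). [folklore] -/
theorem visc_succ_lt (m : ℕ) : Cheskidov2023.visc (m + 1) < Cheskidov2023.visc m := by
  unfold Cheskidov2023.visc
  push_cast
  have hp : (0 : ℝ) < (m : ℝ) + 1 := by positivity
  have hq : (0 : ℝ) < ((m : ℝ) + 1) ^ (7 / 4 : ℝ) := Real.rpow_pos_of_pos hp _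
  have h25 : (0 : ℝ) < (25 : ℝ) ^ m := pow_pos (by norm_num) m
  have hmono : ((m : ℝ) + 1 + 1) ^ (7 / 4 : ℝ) ≤ (2 * ((m : ℝ) + 1)) ^ (7 / 4 : ℝ) :=
    Real.rpow_le_rpow (by positivity) (by linarith) (by norm_num)
  have hsplit : (2 * ((m : ℝ) + 1)) ^ (7 / 4 : ℝ) = (2 : ℝ) ^ (7 / 4 : ℝ) * ((m : ℝ) + 1) ^ (7 / 4 : ℝ) :=
    Real.mul_rpow (by norm_num) hp.le
  have h4 : (2 : ℝ) ^ (7 / 4 : ℝ) < 25 := by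
    calc (2 : ℝ) ^ (7 / 4 : ℝ) ≤ (2 : ℝ) ^ (2 : ℝ) :=
          Real.rpow_le_rpow_of_exponent_le (by norm_num) (by norm_num)
      _ = 4 := by rw [Real.rpow_two]; norm_num
      _ < 25 := by norm_num
  have h25' : (0 : ℝ) < (25 : ℝ) ^ (m + 1) := pow_pos (by norm_num) _
  rw [div_lt_div_iff₀ h25' h25, pow_succ]
  calc ((m : ℝ) + 1 + 1) ^ (7 / 4 : ℝ) * (25 : ℝ) ^ m
      ≤ (2 : ℝ) ^ (7 / 4 : ℝ) * ((m : ℝ) + 1) ^ (7 / 4 : ℝ) * 25 ^ m := by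
        rw [← hsplit]; exact mul_le_mul_of_nonneg_right hmono h25.le
    _ < 25 * ((m : ℝ) + 1) ^ (7 / 4 : ℝ) * 25 ^ m :=
        mul_lt_mul_of_pos_right (mul_lt_mul_of_pos_right h4 hq) h25
    _ = ((m : ℝ) + 1) ^ (7 / 4 : ℝ) * (25 ^ m * 25) := by ring

/-- Cheskidov's viscosities are strictly decreasing. [folklore] -/
theorem strictAnti_visc : StrictAnti Cheskidov2023.visc := strictAnti_nat_of_succ_lt visc_succ_lt

/-- Cheskidov's viscosities form a vanishing-viscosity sequence in the sense of
`AnomalousDissipation.lean` (strictly decreasing, positive, `ν_m → 0`). [cite: BrueDeLellisCMP2023, Thm. 1.1] -/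
theorem isVanishingViscosity_visc : IsVanishingViscosity Cheskidov2023.visc :=
  ⟨strictAnti_visc, Cheskidov2023.tendsto_visc, Cheskidov2023.visc_pos⟩

/-- **The sharp viscous error with Cheskidov's viscosities tends to zero**:
`ν_m Bσ (m+1)(m+2) (c₀ λ_m + K λ_m^{1+r}) → 0` for `0 ≤ r < 1`, since
`ν_m poly(m) λ_m^{1+r} = poly(m) λ_m^{r-1}` (Bruè–De Lellis 2023, Lemma 5.1: `poly λ^{α-1} → 0`). [cite: BrueDeLellisCMP2023, Lemma 5.1] -/
theorem tendsto_viscHolderErr {c₀ K Bσ r : ℝ} (hr1 : r < 1) :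
    Tendsto (fun m : ℕ => Cheskidov2023.visc m * (Bσ * (((m : ℝ) + 1) * (m + 2))) *
      (c₀ * 5 ^ m + K * ((5 : ℝ) ^ m) ^ (1 + r))) atTop (𝓝 0) := by
  -- the `λ_m` part: `ν_m (m+1)(m+2) 5^m → 0`
  have t1 : Tendsto (fun m : ℕ => Bσ * c₀ *
      (Cheskidov2023.visc m * (((m : ℝ) + 1) * (m + 2) * 5 ^ m))) atTop (𝓝 0) := by
    have := Cheskidov2023.tendsto_visc_mul.const_mul (Bσ * c₀)
    rwa [mul_zero] at this
  -- the `λ_m^{1+r}` part: `ν_m (m+1)(m+2) (5^m)^{1+r} ≤ ((m+1)(m+2))² σ^m`, `σ = 5^{r-1} < 1`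
  set σ : ℝ := (5 : ℝ) ^ (r - 1) with hσ
  have hσ0 : 0 ≤ σ := Real.rpow_nonneg (by norm_num) _
  have hσ1 : σ < 1 := Real.rpow_lt_one_of_one_lt_of_neg (by norm_num) (by linarith)
  have hpoly := tendsto_poly_sq_mul_pow hσ0 hσ1
  have hb : ∀ m : ℕ, |Cheskidov2023.visc m * (((m : ℝ) + 1) * (m + 2)) * ((5 : ℝ) ^ m) ^ (1 + r)| ≤
      (((m : ℝ) + 1) * (m + 2)) ^ 2 * σ ^ m := by
    intro m
    have h5 : (0 : ℝ) < (5 : ℝ) ^ m := pow_pos (by norm_num) m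
    have h5' : (5 : ℝ) ^ m ≠ 0 := h5.ne'
    have hv0 := (Cheskidov2023.visc_pos m).le
    rw [abs_of_nonneg (by positivity)]
    have hq : ((5 : ℝ) ^ m) ^ (1 + r) = (5 : ℝ) ^ m * (5 : ℝ) ^ m * σ ^ m := by
      have e1 : ((5 : ℝ) ^ m) ^ (1 + r) = ((5 : ℝ) ^ m) ^ (2 : ℝ) * ((5 : ℝ) ^ m) ^ (r - 1) := by
        rw [← Real.rpow_add h5]; congr 1; ring
      have e2 : ((5 : ℝ) ^ m) ^ (r - 1) = σ ^ m := by
        rw [hσ, ← Real.rpow_natCast (5 : ℝ) m, ← Real.rpow_mul (by norm_num : (0 : ℝ) ≤ 5),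
          show ((m : ℝ) * (r - 1)) = (r - 1) * m by ring, Real.rpow_mul (by norm_num : (0 : ℝ) ≤ 5),
          Real.rpow_natCast]
      rw [e1, e2, Real.rpow_two]; ring
    unfold Cheskidov2023.visc
    have h25 : (25 : ℝ) ^ m = 5 ^ m * 5 ^ m := by rw [← mul_pow]; norm_num
    rw [h25, hq]
    have hp := Cheskidov2023.rpow_seven_fourths_le_sq m
    have hm0 : (0 : ℝ) ≤ m := Nat.cast_nonneg m
    have hσm : 0 ≤ σ ^ m := pow_nonneg hσ0 m
    have hB : (5 : ℝ) ^ m * 5 ^ m ≠ 0 := by positivity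
    calc ((m : ℝ) + 1) ^ (7 / 4 : ℝ) / (5 ^ m * 5 ^ m) * (((m : ℝ) + 1) * (m + 2)) * (5 ^ m * 5 ^ m * σ ^ m)
        = ((m : ℝ) + 1) ^ (7 / 4 : ℝ) * (((m : ℝ) + 1) * (m + 2)) * σ ^ m := by
          rw [div_mul_eq_mul_div, div_mul_eq_mul_div, div_eq_iff hB]; ring
      _ ≤ ((m : ℝ) + 1) ^ 2 * (((m : ℝ) + 1) * (m + 2)) * σ ^ m := by gcongr
      _ ≤ (((m : ℝ) + 1) * (m + 2)) ^ 2 * σ ^ m := by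
          refine mul_le_mul_of_nonneg_right ?_ hσm
          nlinarith [sq_nonneg ((m : ℝ) + 1), mul_nonneg (sq_nonneg ((m : ℝ) + 1)) (show (0 : ℝ) ≤ m + 2 by positivity)]
  have t2 : Tendsto (fun m : ℕ => Bσ * K *
      (Cheskidov2023.visc m * (((m : ℝ) + 1) * (m + 2)) * ((5 : ℝ) ^ m) ^ (1 + r))) atTop (𝓝 0) := by
    have h0 : Tendsto (fun m : ℕ =>
        Cheskidov2023.visc m * (((m : ℝ) + 1) * (m + 2)) * ((5 : ℝ) ^ m) ^ (1 + r)) atTop (𝓝 0) :=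
      squeeze_zero_norm (fun m => by rw [Real.norm_eq_abs]; exact hb m) hpoly
    have := h0.const_mul (Bσ * K)
    rwa [mul_zero] at this
  have := t1.add t2
  rw [add_zero] at this
  refine this.congr fun m => ?_
  ring

/-! ## The viscous term of the forces in `C^{0,r}`, sharp form (BDL Lemma 5.1 / (5.4)) -/

section Viscous

variable {d : Type*} [Fintype d] [DecidableEq d]
variable {ρ : ℕ → ℝ → UnitAddTorus d → ℝ} {v : ℕ → ℝ → UnitAddTorus d → EuclideanSpace ℝ d}
variable {A Bσ Bσ' : ℝ} {m n : ℕ}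

/-- **The viscous term on a block in `C^{0,r}`, sharp form**: for `n ≤ m`, `ν ≥ 0`, `r ≤ 1`,
`‖ν Δ(blockDrift v n (t))‖_{C^{0,r}} ≤ ν Bσ (m+1)(m+2) (d A λ_m + (√d d² A)^r (2dA)^{1-r} λ_m^{1+r})`,
`λ_m = 5^m` — the interpolation `‖ΔV‖_{C^{0,r}} ≤ dK₂ + (√d d (dK₃))^r (2dK₂)^{1-r}` with
`K₂ = Aλ_n`, `K₃ = Aλ_n²` (`Gluing.eBoundedHolderNorm_laplacian_le`) read without the crude bound
`λ^{1+r} ≤ λ³` of `Gluing.eBoundedHolderNorm_viscous_le` (Bruè–De Lellis 2023, (5.4) with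
Thm. 4.1 (a): `ν_q‖Δv^q‖_{C^α} ≲ ν_q poly λ_q^{1+α}`; Cheskidov 2023, (3.13)). [cite: BrueDeLellisCMP2023, §5 (5.4) and Lemma 5.1] -/
theorem eBoundedHolderNorm_viscous_le_sharp (hv : Torus.IsSmoothSpaceTimeOn (Icc 0 1) (v n))
    (hK : BlockDerivBounds v A) (hBσ : ∀ n t, |deriv (sigma n) t| ≤ Bσ / tau n) (hnm : n ≤ m)
    {ν : ℝ} (hν : 0 ≤ ν) (t : ℝ) {r : ℝ≥0} (hr : r ≤ 1) :
    eBoundedHolderNorm r (fun x => ν • Torus.laplacian (blockDrift v n t) x) ≤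
      ENNReal.ofReal (ν * (Bσ * (((m : ℝ) + 1) * (m + 2))) *
        (Fintype.card d * A * 5 ^ m +
          (Real.sqrt (Fintype.card d) * Fintype.card d ^ 2 * A) ^ (r : ℝ) *
            (2 * Fintype.card d * A) ^ (1 - (r : ℝ)) * ((5 : ℝ) ^ m) ^ (1 + (r : ℝ)))) := by
  have hs := sigma_mem_Icc n t
  set V := v n (sigma n t) with hVdef
  have hVsm : Torus.IsSmooth V := hv.isSmooth_slice hs
  have hA := hK.nonneg
  have hc := hBσ n t
  rw [div_tau] at hc
  have hB0 := nonneg_of_abs_deriv_sigma_le hBσ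
  -- `ν Δ(c₁ V) = (ν c₁) • ΔV`
  have hfun : (fun x => ν • Torus.laplacian (blockDrift v n t) x) =
      (ν * deriv (sigma n) t) • Torus.laplacian V := by
    funext x
    have heq : blockDrift v n t = deriv (sigma n) t • V := rfl
    rw [heq, Torus.laplacian_const_smul' hVsm, Pi.smul_apply, smul_smul]
  rw [hfun, eBoundedHolderNorm_const_smul]
  have hΔ := eBoundedHolderNorm_laplacian_le (K₂ := A * 5 ^ n) (K₃ := A * 25 ^ n) hVsm
    (fun x i j => hK.partialDeriv_two_le n _ hs x i j)
    (fun x i j l => hK.partialDeriv_three_le n _ hs x i j l) (by positivity) (by positivity) hr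
  set d' : ℝ := (Fintype.card d : ℝ) with hd'
  have hd0 : 0 ≤ d' := Nat.cast_nonneg _
  set a : ℝ := Real.sqrt d' * d' ^ 2 * A with ha_def
  set b : ℝ := 2 * d' * A with hb_def
  have ha0 : 0 ≤ a := by positivity
  have hb0 : 0 ≤ b := by positivity
  have h5n : (0 : ℝ) < 5 ^ n := pow_pos (by norm_num) n
  have h5nm : (5 : ℝ) ^ n ≤ 5 ^ m := pow_le_pow_right₀ (by norm_num) hnm
  -- the interpolated term is `a^r b^{1-r} λ_n^{1+r}`
  have hkey : (Real.sqrt d' * (d' * (d' * (A * 25 ^ n)))) ^ (r : ℝ) *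
      (2 * (d' * (A * 5 ^ n))) ^ (1 - (r : ℝ)) =
      a ^ (r : ℝ) * b ^ (1 - (r : ℝ)) * ((5 : ℝ) ^ n) ^ (1 + (r : ℝ)) := by
    have e25 : (25 : ℝ) ^ n = ((5 : ℝ) ^ n) ^ 2 := by
      rw [← pow_mul, mul_comm, pow_mul]; norm_num
    have e1 : Real.sqrt d' * (d' * (d' * (A * 25 ^ n))) = a * ((5 : ℝ) ^ n) ^ 2 := by
      rw [ha_def, e25]; ring
    have e2 : 2 * (d' * (A * 5 ^ n)) = b * 5 ^ n := by rw [hb_def]; ring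
    rw [e1, e2, Real.mul_rpow ha0 (pow_nonneg h5n.le 2), Real.mul_rpow hb0 h5n.le]
    have e3 : (((5 : ℝ) ^ n) ^ 2) ^ (r : ℝ) = ((5 : ℝ) ^ n) ^ (2 * (r : ℝ)) := by
      rw [← Real.rpow_natCast ((5 : ℝ) ^ n) 2, ← Real.rpow_mul h5n.le]; norm_num
    have e4 : ((5 : ℝ) ^ n) ^ (2 * (r : ℝ)) * ((5 : ℝ) ^ n) ^ (1 - (r : ℝ)) =
        ((5 : ℝ) ^ n) ^ (1 + (r : ℝ)) := by
      rw [← Real.rpow_add h5n]; congr 1; ring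
    rw [e3]
    calc a ^ (r : ℝ) * ((5 : ℝ) ^ n) ^ (2 * (r : ℝ)) * (b ^ (1 - (r : ℝ)) * ((5 : ℝ) ^ n) ^ (1 - (r : ℝ)))
        = a ^ (r : ℝ) * b ^ (1 - (r : ℝ)) * (((5 : ℝ) ^ n) ^ (2 * (r : ℝ)) * ((5 : ℝ) ^ n) ^ (1 - (r : ℝ))) := by
          ring
      _ = _ := by rw [e4]
  have hH : d' * (A * 5 ^ n) + (Real.sqrt d' * (d' * (d' * (A * 25 ^ n)))) ^ (r : ℝ) *
      (2 * (d' * (A * 5 ^ n))) ^ (1 - (r : ℝ)) ≤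
      d' * A * 5 ^ m + a ^ (r : ℝ) * b ^ (1 - (r : ℝ)) * ((5 : ℝ) ^ m) ^ (1 + (r : ℝ)) := by
    rw [hkey]
    refine add_le_add ?_ ?_
    · rw [← mul_assoc]; exact mul_le_mul_of_nonneg_left h5nm (by positivity)
    · exact mul_le_mul_of_nonneg_left (Real.rpow_le_rpow h5n.le h5nm (by positivity)) (by positivity)
  have hmono : ((n : ℝ) + 1) * (n + 2) ≤ ((m : ℝ) + 1) * (m + 2) := by
    have hnm' : (n : ℝ) ≤ m := by exact_mod_cast hnm
    have hn0 : (0 : ℝ) ≤ n := Nat.cast_nonneg n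
    nlinarith
  set E : ℝ := d' * A * 5 ^ m + a ^ (r : ℝ) * b ^ (1 - (r : ℝ)) * ((5 : ℝ) ^ m) ^ (1 + (r : ℝ)) with hE
  calc ‖ν * deriv (sigma n) t‖ₑ * eBoundedHolderNorm r (Torus.laplacian V)
      ≤ ENNReal.ofReal (ν * (Bσ * (((n : ℝ) + 1) * (n + 2)))) * ENNReal.ofReal E := by
        refine mul_le_mul' ?_ (hΔ.trans (ENNReal.ofReal_le_ofReal hH))
        rw [← ofReal_norm, Real.norm_eq_abs, abs_mul, abs_of_nonneg hν]
        exact ENNReal.ofReal_le_ofReal (mul_le_mul_of_nonneg_left hc hν)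
    _ ≤ ENNReal.ofReal (ν * (Bσ * (((m : ℝ) + 1) * (m + 2)))) * ENNReal.ofReal E :=
        mul_le_mul' (ENNReal.ofReal_le_ofReal
          (mul_le_mul_of_nonneg_left (mul_le_mul_of_nonneg_left hmono hB0) hν)) le_rfl
    _ = ENNReal.ofReal (ν * (Bσ * (((m : ℝ) + 1) * (m + 2))) * E) := by
        rw [← ENNReal.ofReal_mul (by positivity)]

variable [Nonempty d]

/-- **Uniform `C^{0,r}` bound on the Navier–Stokes forces of the glued drifts**, `r < 1`:
`sup_{m, t} ‖g^m(t)‖_{C^{0,r}} < ∞` for `g^m = ∂ₜv^m + (v^m·∇)v^m - ν_mΔv^m` with Cheskidov's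
viscosities (Bruè–De Lellis 2023, (1.2) via (5.4) and Lemma 5.1: on the gluing interval of block
`j ≤ m`, `g^m(t) = blockForce v j (t) - ν_mΔ(blockDrift v j (t))` with the block force bounded by a
null sequence in `j` (`Gluing.blockForce_bounds`, `Gluing.tendsto_profileForceBound`) and the viscous
term bounded by a null sequence in `m` (`eBoundedHolderNorm_viscous_le_sharp`,
`tendsto_viscHolderErr`); elsewhere `g^m = 0`). [cite: BrueDeLellisCMP2023, Thm. 3.1 (1) and Lemma 5.1] -/
theorem exists_forall_eBoundedHolderNorm_nsBodyForce_le (hB : Blocks ρ v) (hK : BlockDerivBounds v A)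
    (hBσ : ∀ n t, |deriv (sigma n) t| ≤ Bσ / tau n)
    (hBσ' : ∀ n t, |deriv (deriv (sigma n)) t| ≤ Bσ' / tau n ^ 2) {r : ℝ≥0} (hr : r < 1) :
    ∃ C : ℝ≥0∞, C < ∞ ∧ ∀ (m : ℕ) (t : ℝ),
      eBoundedHolderNorm r (Torus.nsBodyForce (Cheskidov2023.visc m) (drift v m) t) ≤ C := by
  classical
  have hr' : r ≤ 1 := hr.le
  have hrr : (r : ℝ) < 1 := by exact_mod_cast hr
  have hA := hK.nonneg
  have hB0' := nonneg_of_abs_deriv_deriv_sigma_le hBσ'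
  have hv : ∀ n, Torus.IsSmoothSpaceTimeOn (Icc 0 1) (v n) := fun n => (hB.sol n).smooth_velocity
  -- the block-force bound is a null sequence in the block index, hence bounded
  set A₁ : ℝ := Bσ' * A + Bσ ^ 2 * (A + Fintype.card d * A ^ 2) with hA₁
  set A₂ : ℝ := Bσ' * A + Bσ ^ 2 * (A + 2 * Fintype.card d * A ^ 2) with hA₂
  set G : ℕ → ℝ := fun n => (((n : ℝ) + 1) * (n + 2)) ^ 2 * (5 ^ n)⁻¹ * A₁ +
      (Real.sqrt (Fintype.card d) * (Fintype.card d * ((((n : ℝ) + 1) * (n + 2)) ^ 2 * A₂))) ^ (r : ℝ) *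
        (2 * ((((n : ℝ) + 1) * (n + 2)) ^ 2 * (5 ^ n)⁻¹ * A₁)) ^ (1 - (r : ℝ)) with hG
  have hGlim : Tendsto G atTop (𝓝 0) := by
    have := tendsto_profileForceBound (A₁ := A₁) (A₂ := A₂)
      (c := Real.sqrt (Fintype.card d) * Fintype.card d) (r := r)
      (by positivity) (by positivity) (by positivity) hrr
    refine this.congr fun n => ?_
    simp only [hG]; ring_nf
  obtain ⟨Cg, hCg⟩ := hGlim.bddAbove_range
  have hGle : ∀ n, G n ≤ Cg := fun n => hCg ⟨n, rfl⟩
  -- the viscous bound is a null sequence in `m`, hence bounded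
  set d' : ℝ := (Fintype.card d : ℝ) with hd'
  set a : ℝ := Real.sqrt d' * d' ^ 2 * A with ha_def
  set b : ℝ := 2 * d' * A with hb_def
  set Vb : ℕ → ℝ := fun m => Cheskidov2023.visc m * (Bσ * (((m : ℝ) + 1) * (m + 2))) *
      (d' * A * 5 ^ m + a ^ (r : ℝ) * b ^ (1 - (r : ℝ)) * ((5 : ℝ) ^ m) ^ (1 + (r : ℝ))) with hVb
  have hVlim : Tendsto Vb atTop (𝓝 0) := tendsto_viscHolderErr hrr
  obtain ⟨Cv, hCv⟩ := hVlim.bddAbove_range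
  have hVle : ∀ m, Vb m ≤ Cv := fun m => hCv ⟨m, rfl⟩
  refine ⟨ENNReal.ofReal Cg + ENNReal.ofReal Cv,
    ENNReal.add_lt_top.2 ⟨ENNReal.ofReal_lt_top, ENNReal.ofReal_lt_top⟩, fun m t => ?_⟩
  by_cases ht : 0 ≤ t ∧ t < tn (m + 1)
  · have ht1 : t < 1 := ht.2.trans (tn_lt_one _)
    have hmem := mem_Ico_tn_blockIdx ht.1 ht1
    have hjm : blockIdx t ≤ m := blockIdx_le_of_lt_tn_succ ht.2
    have hfun : Torus.nsBodyForce (Cheskidov2023.visc m) (drift v m) t =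
        blockForce v (blockIdx t) t +
          (-1 : ℝ) • fun x => Cheskidov2023.visc m • Torus.laplacian (blockDrift v (blockIdx t) t) x := by
      funext x
      rw [Pi.add_apply, Pi.smul_apply, nsBodyForce_drift_eq hB _ hjm hmem x, neg_one_smul,
        sub_eq_add_neg]
    rw [hfun]
    refine (eBoundedHolderNorm_add_le _ _).trans (add_le_add ?_ ?_)
    · exact (blockForce_bounds (hv _) hK hBσ hBσ' t hr').2.trans (ENNReal.ofReal_le_ofReal (hGle (blockIdx t)))
    · rw [eBoundedHolderNorm_const_smul]
      simp only [enorm_neg, enorm_one, one_mul]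
      exact (eBoundedHolderNorm_viscous_le_sharp (hv _) hK hBσ hjm (Cheskidov2023.visc_pos m).le t hr').trans
        (ENNReal.ofReal_le_ofReal (hVle m))
  · have hzero : Torus.nsBodyForce (Cheskidov2023.visc m) (drift v m) t = 0 := by
      funext x
      rw [not_and_or, not_le, not_lt] at ht
      exact nsBodyForce_drift_eq_zero hB _ ht x
    rw [hzero, eBoundedHolderNorm_zero]
    exact bot_le

end Viscous

/-! ## Jointly smooth fields are continuous in time with values in `C^{0,r}`, `r < 1` -/

section HolderContinuity

variable {d : Type*} [Fintype d] [DecidableEq d]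
variable {Y : Type*} [NormedAddCommGroup Y] [NormedSpace ℝ Y]

/-- **`C^∞([a,b] × T^d) ⊆ C([a,b]; C^{0,r}(T^d))` for `r < 1`.** A jointly smooth field on
`[a,b] × T^d`, `a < b`, is, at each time, in `C^{0,r}_b`, and `t ↦ u t` is continuous on `[a,b]`
for the `C^{0,r}` norm: by the interpolation `‖g‖_{C^{0,r}} ≤ M + (√d d L)^r (2M)^{1-r}` from
`‖g‖ ≤ M`, `‖∂ᵢg‖ ≤ L` (`Gluing.eBoundedHolderNorm_le_interp`) applied to `g = u t - u t₀`, with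
`M → 0` as `t → t₀` (tube lemma over the compact torus,
`IsSmoothSpaceTimeOn.eventually_norm_sub_lt`) and `L` a uniform bound of the spatial derivatives on
the compact time set. This is the continuity half of the clause `f ∈ C([0,1]; C^α)` of
Bruè–De Lellis 2023, (1.2), for smooth `f`. [folklore] -/
theorem continuousInHolderOn_of_isSmoothSpaceTimeOn {u : ℝ → UnitAddTorus d → Y} {a b : ℝ}
    (hab : a < b) (hu : Torus.IsSmoothSpaceTimeOn (Icc a b) u) {r : ℝ≥0} (hr : r < 1) :
    ContinuousInHolderOn (Icc a b) r u := by
  classical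
  have hS : UniqueDiffOn ℝ (Icc a b) := uniqueDiffOn_Icc hab
  have hcpt : IsCompact (Icc a b) := isCompact_Icc
  have hrr : (r : ℝ) < 1 := by exact_mod_cast hr
  -- uniform bounds on `u` and its spatial partial derivatives over `[a,b] × T^d`
  obtain ⟨M₀, hM₀⟩ := hu.exists_norm_le_of_isCompact hcpt subset_rfl
  have hLi : ∀ i, ∃ L : ℝ, ∀ t ∈ Icc a b, ∀ x, ‖Torus.partialDeriv i (u t) x‖ ≤ L := fun i =>
    (hu.partialDeriv hS i).exists_norm_le_of_isCompact hcpt subset_rfl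
  choose Lf hLf using hLi
  set L : ℝ := ∑ i, |Lf i| with hL
  have hL0 : 0 ≤ L := Finset.sum_nonneg fun i _ => abs_nonneg _
  have hLi' : ∀ i, ∀ t ∈ Icc a b, ∀ x, ‖Torus.partialDeriv i (u t) x‖ ≤ L := fun i t ht x =>
    ((hLf i t ht x).trans (le_abs_self _)).trans
      (Finset.single_le_sum (f := fun i => |Lf i|) (fun i _ => abs_nonneg _) (Finset.mem_univ i))
  set M : ℝ := max M₀ 0 with hM
  have hM0 : 0 ≤ M := le_max_right _ _
  have hMu : ∀ t ∈ Icc a b, ∀ x, ‖u t x‖ ≤ M := fun t ht x => (hM₀ t ht x).trans (le_max_left _ _)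
  have hsl : ∀ t ∈ Icc a b, Torus.IsContDiff 1 (u t) := fun t ht =>
    (hu.isSmooth_slice ht).isContDiff (by simp)
  refine ⟨fun t ht => ?_, fun t₀ ht₀ => ?_⟩
  · exact lt_of_le_of_lt (eBoundedHolderNorm_le_interp (hsl t ht) hr.le hM0 hL0 (hMu t ht)
      (fun i x => hLi' i t ht x)) ENNReal.ofReal_lt_top
  · rw [ENNReal.tendsto_nhds_zero]
    intro ε hε
    by_cases hεtop : ε = ⊤
    · exact Eventually.of_forall fun t => by rw [hεtop]; exact le_top
    have hε' : 0 < ε.toReal := ENNReal.toReal_pos hε.ne' hεtop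
    -- the interpolated modulus `δ ↦ δ + (√d d (2L))^r (2δ)^{1-r}` is continuous at `0`
    set K : ℝ := (Real.sqrt (Fintype.card d) * (Fintype.card d * (2 * L))) ^ (r : ℝ) with hK
    have hg : Tendsto (fun δ : ℝ => δ + K * (2 * δ) ^ (1 - (r : ℝ))) (𝓝 0) (𝓝 0) := by
      have h1 : Tendsto (fun δ : ℝ => 2 * δ) (𝓝 0) (𝓝 0) := by
        simpa using (tendsto_id (x := 𝓝 (0 : ℝ))).const_mul 2
      have h2 := h1.rpow_const_nhds_zero (p := 1 - (r : ℝ)) (by linarith)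
      have h3 := h2.const_mul K
      rw [mul_zero] at h3
      simpa using (tendsto_id (x := 𝓝 (0 : ℝ))).add h3
    have hev : ∀ᶠ δ in 𝓝 (0 : ℝ), δ + K * (2 * δ) ^ (1 - (r : ℝ)) < ε.toReal :=
      hg (Iio_mem_nhds hε')
    obtain ⟨η, hη, hηball⟩ := Metric.eventually_nhds_iff.1 hev
    set δ : ℝ := η / 2 with hδ
    have hδpos : 0 < δ := half_pos hη
    have hδlt : δ + K * (2 * δ) ^ (1 - (r : ℝ)) < ε.toReal :=
      hηball (by rw [Real.dist_eq, sub_zero, abs_of_pos hδpos, hδ]; linarith)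
    have htube := hu.eventually_norm_sub_lt ht₀ hδpos
    filter_upwards [htube, self_mem_nhdsWithin] with s hs hsS
    have heq : u s - u t₀ = u s + (-1 : ℝ) • u t₀ := by
      rw [neg_one_smul, sub_eq_add_neg]
    have hdiff : Torus.IsContDiff 1 (u s + (-1 : ℝ) • u t₀) := (hsl s hsS).add ((hsl t₀ ht₀).smul _)
    have h0 : ∀ x, ‖(u s + (-1 : ℝ) • u t₀) x‖ ≤ δ := fun x => by
      rw [← heq]
      exact (hs x).le
    have h1 : ∀ i x, ‖Torus.partialDeriv i (u s + (-1 : ℝ) • u t₀) x‖ ≤ 2 * L := by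
      intro i x
      rw [Torus.partialDeriv_add (hsl s hsS) ((hsl t₀ ht₀).smul _),
        Torus.partialDeriv_const_smul (hsl t₀ ht₀), Pi.add_apply, Pi.smul_apply]
      calc ‖Torus.partialDeriv i (u s) x + (-1 : ℝ) • Torus.partialDeriv i (u t₀) x‖
          ≤ ‖Torus.partialDeriv i (u s) x‖ + ‖(-1 : ℝ) • Torus.partialDeriv i (u t₀) x‖ := norm_add_le _ _
        _ ≤ L + L := by
            rw [norm_smul, norm_neg, norm_one, one_mul]
            exact add_le_add (hLi' i s hsS x) (hLi' i t₀ ht₀ x)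
        _ = 2 * L := by ring
    rw [heq]
    calc eBoundedHolderNorm r (u s + (-1 : ℝ) • u t₀)
        ≤ ENNReal.ofReal (δ + (Real.sqrt (Fintype.card d) * (Fintype.card d * (2 * L))) ^ (r : ℝ) *
            (2 * δ) ^ (1 - (r : ℝ))) :=
          eBoundedHolderNorm_le_interp hdiff hr.le hδpos.le (by positivity) h0 h1
      _ ≤ ENNReal.ofReal ε.toReal := ENNReal.ofReal_le_ofReal hδlt.le
      _ ≤ ε := ENNReal.ofReal_toReal_le

end HolderContinuity

end BrueDeLellis2023

/-! ## The reduction -/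

open Gluing BrueDeLellis2023 Literature.Analysis.FunctionSpaces in
open Literature.Analysis.FunctionSpaces.Torus (twoHalf planarProj) in
/-- **Bruè–De Lellis' Theorem 1.1 from the glued blocks and parabolic well-posedness.** From
blocks `(ρₙ, vₙ)` — classical transport solutions on `[0,1] × T²` handed over continuously
(`Gluing.Blocks`), with the scalar clauses of BDL Thm. 4.1 (b) (zero mean, unit `L²` norm,
`|ρₙ| ≤ 10`, `‖∇ρₙ‖ ≤ Cλₙ`, `‖ρₙ‖_{Ḣ⁻¹} ≤ Cλₙ⁻¹`) and the velocity bounds `Gluing.BlockDerivBounds`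
of Thm. 4.1 (a) — and classical parabolic well-posedness on `T²`
(`Torus.exists_unique_isClassicalScalarTransportForcedOn`), the fact
`brue_deLellis_anomalous_dissipation` (source, Thm. 1.1 / Thm. 3.1) follows with the witnesses of
§5: viscosities `ν_m = (m+1)^{7/4}λ_m⁻²` (Cheskidov's (4.13); strictly decreasing,
`strictAnti_visc`), drifts `v^m = Gluing.drift v m`, viscous scalars `θ^m` on `[0,2]`, datum
`u₀ = (0, ρ₀(0)) ∘ π`, velocities `u^m = (v^m, θ^m) ∘ π`, zero pressure, forces
`f^m = (g^m, 0) ∘ π`, `g^m = ∂ₜv^m + (v^m·∇)v^m - ν_mΔv^m` ((5.4); `Torus.nsBodyForce`): the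
Navier–Stokes system on `[0,1] × T³` by `Cheskidov.isClassicalNSSolutionOn_family` restricted to
`[0,1]`; the force bounds (1.2) by `exists_forall_eBoundedHolderNorm_nsBodyForce_le`,
`Torus.eBoundedHolderNorm_twoHalf_zero_right_le` and
`continuousInHolderOn_of_isSmoothSpaceTimeOn`; and (1.3) in the `ε`-form with `ε = 1/4`, since
`ν_m ∫₀¹ ‖∇u^m‖² ≥ ν_m ∫₀¹ ‖∇θ^m‖² = (1 - ‖θ^m(1)‖²)/2` (energy identity) and `‖θ^m(1)‖² → 0`
(total dissipation, the argument of `cheskidov_total_dissipation_family_of_acm_family`). [cite: BrueDeLellisCMP2023, Thm. 1.1, Thm. 3.1 and §5 (5.1)–(5.4)] -/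
theorem brue_deLellis_anomalous_dissipation_of_blocks
    {ρb : ℕ → ℝ → UnitAddTorus (Fin 2) → ℝ}
    {vb : ℕ → ℝ → UnitAddTorus (Fin 2) → EuclideanSpace ℝ (Fin 2)} {A : ℝ} (hB : Gluing.Blocks ρb vb)
    (hb : ∀ n : ℕ, ∀ s ∈ Icc (0 : ℝ) 1,
      Torus.HasZeroMean (ρb n s) ∧ ∫ x, ρb n s x ^ 2 = 1 ∧ ∀ x, |ρb n s x| ≤ 10)
    (hCH : ∃ C : ℝ, ∀ n : ℕ, ∀ s ∈ Icc (0 : ℝ) 1,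
      (∀ x, ‖Torus.gradient (ρb n s) x‖ ≤ C * 5 ^ n) ∧
      Torus.eHomSobolevSeminorm (-1) (fun x => (ρb n s x : ℂ)) ≤ ENNReal.ofReal (C * (5 ^ n)⁻¹))
    (hK : Gluing.BlockDerivBounds vb A)
    (hwp : Torus.exists_unique_isClassicalScalarTransportForcedOn (d := Fin 2)) :
    brue_deLellis_anomalous_dissipation := by
  classical
  obtain ⟨C, hCH⟩ := hCH
  have hgrad : ∀ n : ℕ, ∀ s ∈ Icc (0 : ℝ) 1, ∀ x, ‖Torus.gradient (ρb n s) x‖ ≤ C * 5 ^ n :=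
    fun n s hs => (hCH n s hs).1
  have hH : ∀ n : ℕ, ∀ s ∈ Icc (0 : ℝ) 1,
      Torus.eHomSobolevSeminorm (-1) (fun x => (ρb n s x : ℂ)) ≤ ENNReal.ofReal (C * (5 ^ n)⁻¹) :=
    fun n s hs => (hCH n s hs).2
  have h01 : (0 : ℝ) ∈ Icc (0 : ℝ) 1 := ⟨le_rfl, zero_le_one⟩
  have hC0 : 0 ≤ C := by
    have := hgrad 0 0 h01 0
    simp only [pow_zero, mul_one] at this
    exact (norm_nonneg _).trans this
  obtain ⟨Bσ, -, hBσ⟩ := exists_forall_abs_deriv_sigma_le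
  obtain ⟨Bσ', -, hBσ'⟩ := exists_forall_abs_deriv_deriv_sigma_le
  have hvS : ∀ m, Torus.IsSmoothSpaceTimeOn univ (drift vb m) := isSmoothSpaceTimeOn_drift hB
  -- the datum
  set ρin : UnitAddTorus (Fin 2) → ℝ := ρb 0 0 with hρin
  have hρin_smooth : Torus.IsSmooth ρin := (hB.sol 0).smooth_scalar.isSmooth_slice h01
  have hρin_sq : ∫ x, ρin x ^ 2 = 1 := (hb 0 0 h01).2.1
  -- the viscous scalars `θ^m` on `[0,2]` (parabolic well-posedness; BDL (3.12), Cheskidov (4.2))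
  have hex : ∀ m : ℕ, ∃ θ : ℝ → UnitAddTorus (Fin 2) → ℝ,
      Torus.IsClassicalScalarTransportOn (Icc 0 2) (Cheskidov2023.visc m) (drift vb m) θ ∧ θ 0 = ρin :=
    fun m => by
    obtain ⟨θ, hθ, h0, -⟩ := Torus.exists_unique_isClassicalScalarTransportOn_of_forced hwp
      (Cheskidov2023.visc_pos m) two_pos ((hvS m).mono (subset_univ _))
      (fun t _ => isDivFree_drift hB m t) hρin_smooth
    exact ⟨θ, hθ, h0⟩
  choose θ hθ hθ0 using hex
  /- ### Total dissipation `‖θ^m(1)‖² → 0` (the argument of `CheskidovTotalDissipationProofs`) -/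
  have hρcl : ∀ m, Torus.IsClassicalScalarTransportOn (Icc 0 2) 0 (drift vb m) (profile ρb m) :=
    fun m => isClassicalScalarTransportOn_profile hB m (uniqueDiffOn_Icc two_pos)
  have hsame : ∀ m, θ m 0 = profile ρb m 0 := fun m => by rw [hθ0 m, profile_zero]
  have htn2 : ∀ m, tn (m + 1) < 2 := fun m => (tn_lt_one _).trans one_lt_two
  have hI1 : ∀ m, Icc (0 : ℝ) (tn (m + 1)) ⊆ Icc 0 2 := fun m => Icc_subset_Icc le_rfl (htn2 m).le
  have hI2 : ∀ m, Icc (tn (m + 1)) 2 ⊆ Icc (0 : ℝ) 2 := fun m => Icc_subset_Icc (tn_nonneg _) le_rfl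
  have hE0 : ∀ m, ∀ t ∈ Icc (0 : ℝ) 2, ∫ x, θ m t x ^ 2 ≤ 1 := fun m t ht => by
    have h : Torus.scalarL2Sq (θ m t) ≤ Torus.scalarL2Sq (θ m 0) :=
      (hθ m).antitoneOn_scalarL2Sq (Cheskidov2023.visc_pos m).le (subset_refl (Icc (0 : ℝ) 2))
        ⟨le_rfl, zero_le_two⟩ ht ht.1
    have h0 : Torus.scalarL2Sq (θ m 0) = 1 := by rw [hθ0 m]; exact hρin_sq
    rw [h0] at h
    exact h
  set E1 : ℕ → ℝ := fun m => Cheskidov2023.visc m * (C ^ 2 * (2 * 25 ^ m * tau m)) with hE1_def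
  have hE1 : ∀ m, ∀ t ∈ Icc (0 : ℝ) (tn (m + 1)), ∫ x, (θ m t x - profile ρb m t x) ^ 2 ≤ E1 m :=
    fun m t ht => by
    have h := (hθ m).integral_sub_sq_le_of_mem_Icc (hρcl m) (Cheskidov2023.visc_pos m).le (hI1 m) (hsame m) ht
    have hdiss := scalarDissipation_profile_le hB hgrad (Cheskidov2023.visc_pos m).le m
    have hnn : 0 ≤ Torus.scalarDissipation (Cheskidov2023.visc m) (profile ρb m) 0 (tn (m + 1)) :=
      Torus.scalarDissipation_nonneg (Cheskidov2023.visc_pos m).le _ (tn_nonneg _)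
    linarith
  have hE1_tendsto : Tendsto E1 atTop (𝓝 0) := Cheskidov2023.tendsto_visc_mul_tau C
  have hdrift0 : ∀ m, ∀ t ∈ Icc (tn (m + 1)) (2 : ℝ), drift vb m t = 0 := fun m t ht =>
    drift_eq_zero_of_ge vb ht.1
  have h1mem : ∀ m, (1 : ℝ) ∈ Icc (tn (m + 1)) 2 := fun m => ⟨(tn_lt_one _).le, one_le_two⟩
  set RHS : ℕ → ℝ≥0∞ := fun m =>
    2 * ENNReal.ofReal (E1 m) +
      2 * (ENNReal.ofReal ((Cheskidov2023.freqCut m : ℝ) ^ 2) * ENNReal.ofReal (C * (5 ^ m)⁻¹) ^ 2) +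
      ENNReal.ofReal (Real.exp (-(8 * Real.pi ^ 2 * Cheskidov2023.visc m *
        (Cheskidov2023.freqCut m : ℝ) ^ 2) * (1 - tn (m + 1)))) with hRHS_def
  have hkey : ∀ m, eLpNorm (θ m 1) 2 volume ^ 2 ≤ RHS m := fun m => by
    have hT₁ : tn (m + 1) ∈ Icc (0 : ℝ) 2 := ⟨tn_nonneg _, (htn2 m).le⟩
    have hθT : Torus.IsSmooth (θ m (tn (m + 1))) := (hθ m).smooth_scalar.isSmooth_slice hT₁
    obtain ⟨hprof, hmean1, hH1⟩ := profile_tn_succ hB hb hH m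
    have hρT : Torus.IsSmooth (profile ρb m (tn (m + 1))) := by
      rw [hprof]; exact (hB.sol m).smooth_scalar.isSmooth_slice ⟨zero_le_one, le_rfl⟩
    have hsplit := (hθ m).eLpNorm_sq_le_lowModes_add_exp (Cheskidov2023.visc_pos m).le (htn2 m) (hI2 m)
      (hdrift0 m) (Cheskidov2023.freqCut m) (h1mem m)
    have hlow := Torus.lowModes_le_two_mul_add (Cheskidov2023.freqCut m) (hθT.memLp 2) (hρT.memLp 2)
    have hlowρ : Torus.lowModes (Cheskidov2023.freqCut m) (profile ρb m (tn (m + 1))) ≤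
        ENNReal.ofReal ((Cheskidov2023.freqCut m : ℝ) ^ 2) * ENNReal.ofReal (C * (5 ^ m)⁻¹) ^ 2 := by
      rw [hprof]
      exact Torus.lowModes_le_of_eHomSobolevSeminorm_le hmean1 hH1 (Cheskidov2023.freqCut m)
    have hdiff : eLpNorm (θ m (tn (m + 1)) - profile ρb m (tn (m + 1))) 2 volume ^ 2 ≤
        ENNReal.ofReal (E1 m) := by
      rw [Cheskidov2023.eLpNorm_sq_eq_ofReal_integral_sq ((hθT.sub hρT).memLp 2)]
      exact ENNReal.ofReal_le_ofReal (hE1 m _ ⟨tn_nonneg _, le_rfl⟩)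
    have henergy : eLpNorm (θ m (tn (m + 1))) 2 volume ^ 2 ≤ 1 := by
      rw [Cheskidov2023.eLpNorm_sq_eq_ofReal_integral_sq (hθT.memLp 2), ← ENNReal.ofReal_one]
      exact ENNReal.ofReal_le_ofReal (hE0 m _ hT₁)
    calc eLpNorm (θ m 1) 2 volume ^ 2
        ≤ Torus.lowModes (Cheskidov2023.freqCut m) (θ m (tn (m + 1))) +
            ENNReal.ofReal (Real.exp (-(8 * Real.pi ^ 2 * Cheskidov2023.visc m *
              (Cheskidov2023.freqCut m : ℝ) ^ 2) * (1 - tn (m + 1)))) *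
              eLpNorm (θ m (tn (m + 1))) 2 volume ^ 2 := hsplit
      _ ≤ (2 * ENNReal.ofReal (E1 m) +
            2 * (ENNReal.ofReal ((Cheskidov2023.freqCut m : ℝ) ^ 2) * ENNReal.ofReal (C * (5 ^ m)⁻¹) ^ 2)) +
            ENNReal.ofReal (Real.exp (-(8 * Real.pi ^ 2 * Cheskidov2023.visc m *
              (Cheskidov2023.freqCut m : ℝ) ^ 2) * (1 - tn (m + 1)))) * 1 := by
          gcongr
          calc Torus.lowModes (Cheskidov2023.freqCut m) (θ m (tn (m + 1)))
              ≤ 2 * eLpNorm (θ m (tn (m + 1)) - profile ρb m (tn (m + 1))) 2 volume ^ 2 +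
                  2 * Torus.lowModes (Cheskidov2023.freqCut m) (profile ρb m (tn (m + 1))) := hlow
            _ ≤ 2 * ENNReal.ofReal (E1 m) +
                2 * (ENNReal.ofReal ((Cheskidov2023.freqCut m : ℝ) ^ 2) * ENNReal.ofReal (C * (5 ^ m)⁻¹) ^ 2) := by
                gcongr
      _ = RHS m := by rw [mul_one]
  have hRHS : Tendsto RHS atTop (𝓝 0) := by
    have t1 : Tendsto (fun m => 2 * ENNReal.ofReal (E1 m)) atTop (𝓝 0) := by
      have h := ENNReal.tendsto_ofReal hE1_tendsto
      rw [ENNReal.ofReal_zero] at h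
      simpa using ENNReal.Tendsto.const_mul h (Or.inr ENNReal.ofNat_ne_top)
    have t2 : Tendsto (fun m => 2 * (ENNReal.ofReal ((Cheskidov2023.freqCut m : ℝ) ^ 2) *
        ENNReal.ofReal (C * (5 ^ m)⁻¹) ^ 2)) atTop (𝓝 0) := by
      have h := ENNReal.tendsto_ofReal (Cheskidov2023.tendsto_freqCut_sq_mul C)
      rw [ENNReal.ofReal_zero] at h
      have h' : Tendsto (fun m => ENNReal.ofReal ((Cheskidov2023.freqCut m : ℝ) ^ 2) *
          ENNReal.ofReal (C * (5 ^ m)⁻¹) ^ 2) atTop (𝓝 0) := by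
        refine h.congr fun m => ?_
        rw [← ENNReal.ofReal_pow (mul_nonneg hC0 (by positivity)), ← ENNReal.ofReal_mul (sq_nonneg _)]
      simpa using ENNReal.Tendsto.const_mul h' (Or.inr ENNReal.ofNat_ne_top)
    have t3 : Tendsto (fun m => ENNReal.ofReal (Real.exp (-(8 * Real.pi ^ 2 * Cheskidov2023.visc m *
        (Cheskidov2023.freqCut m : ℝ) ^ 2) * (1 - tn (m + 1))))) atTop (𝓝 0) := by
      have h := ENNReal.tendsto_ofReal Cheskidov2023.tendsto_exp_heat
      rwa [ENNReal.ofReal_zero] at h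
    have h := (t1.add t2).add t3
    rw [add_zero, add_zero] at h
    exact h
  have hsq_tendsto : Tendsto (fun m => eLpNorm (θ m 1) 2 volume ^ 2) atTop (𝓝 0) :=
    tendsto_of_tendsto_of_tendsto_of_le_of_le tendsto_const_nhds hRHS (fun m => zero_le) hkey
  have h12 : (1 : ℝ) ∈ Icc (0 : ℝ) 2 := ⟨zero_le_one, one_le_two⟩
  have hone : Tendsto (fun m => ∫ x, θ m 1 x ^ 2) atTop (𝓝 0) := by
    have h := (ENNReal.tendsto_toReal ENNReal.zero_ne_top).comp hsq_tendsto
    rw [ENNReal.toReal_zero] at h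
    refine h.congr fun m => ?_
    have h1 : Torus.IsSmooth (θ m 1) := (hθ m).smooth_scalar.isSmooth_slice h12
    rw [Function.comp_apply, Cheskidov2023.eLpNorm_sq_eq_ofReal_integral_sq (h1.memLp 2),
      ENNReal.toReal_ofReal (integral_nonneg fun x => sq_nonneg _)]
  -- the energy identity on `[0,1]`: `2ν_m ∫₀¹ ‖∇θ^m‖² = 1 - ‖θ^m(1)‖²`
  have hid : ∀ m, 2 * Cheskidov2023.visc m * ∫ t in (0 : ℝ)..1, Torus.scalarGradNormSq (θ m t) =
      1 - ∫ x, θ m 1 x ^ 2 := by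
    intro m
    have h := Torus.IsClassicalScalarTransportOn.scalarL2Sq_add_scalarDissipation_holds (hθ m) zero_le_one
      (Icc_subset_Icc le_rfl one_le_two)
    simp only [Torus.scalarDissipation, Torus.scalarL2Sq, hθ0 m] at h
    have h2 := hρin_sq
    linarith
  have hev_diss : ∀ᶠ m in atTop,
      (1 : ℝ) / 4 ≤ Cheskidov2023.visc m * ∫ t in (0 : ℝ)..1, Torus.scalarGradNormSq (θ m t) := by
    have hlt : ∀ᶠ m in atTop, ∫ x, θ m 1 x ^ 2 < 1 / 2 := hone (Iio_mem_nhds (by norm_num))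
    filter_upwards [hlt] with m hm
    have := hid m
    linarith
  /- ### The `2½`-dimensional Navier–Stokes family on `[0,1] × T³` (BDL §3.1, (5.4)) -/
  set u : ℕ → ℝ → T3 → R3 := fun m t => twoHalf (drift vb m t) (θ m t) with hu_def
  set f : ℕ → ℝ → T3 → R3 := fun m t =>
    twoHalf (Torus.nsBodyForce (Cheskidov2023.visc m) (drift vb m) t) 0 with hf_def
  set p : ℕ → ℝ → T3 → ℝ := fun _ _ => (fun _ : UnitAddTorus (Fin 2) => (0 : ℝ)) ∘ planarProj with hp_def
  set u₀ : T3 → R3 := twoHalf 0 ρin with hu₀_def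
  have hv0 : ∀ m, ∀ t ∉ Ioo (0 : ℝ) 1, drift vb m t = 0 := fun m t ht => drift_eq_zero_of_not_mem vb ht
  -- Navier–Stokes on `[0,2]`, restricted to `[0,1]`, with the force rewritten as `(g^m, 0) ∘ π`
  have hNS : ∀ m, Torus.IsClassicalNSSolutionOn (Icc 0 1) (Cheskidov2023.visc m) (f m) (u m) (p m) := by
    intro m
    have h2 := (Cheskidov.isClassicalNSSolutionOn_family (ν := Cheskidov2023.visc) (v := drift vb) (θ := θ)
      (hvS m) (hv0 m) (hθ m) (hθ0 m)).1
    have h1 := h2.mono (Icc_subset_Icc le_rfl one_le_two) (uniqueDiffOn_Icc zero_lt_one)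
    refine h1.congr (fun t _ => rfl) fun t ht => ?_
    exact (Cheskidov.twoHalfForce_eq_twoHalf_nsBodyForce (ν := Cheskidov2023.visc) (v := drift vb) (θ := θ)
      (hvS m) (hθ m) ⟨ht.1, ht.2.trans one_le_two⟩).symm
  have hu0 : ∀ m, u m 0 = u₀ := fun m => by
    show twoHalf (drift vb m 0) (θ m 0) = twoHalf 0 ρin
    rw [drift_eq_zero_of_nonpos vb le_rfl, hθ0 m]
  have hu₀_smooth : Torus.IsSmooth u₀ :=
    (Torus.isSmooth_const (0 : EuclideanSpace ℝ (Fin 2))).twoHalf hρin_smooth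
  have hf_smooth : ∀ m, Torus.IsSmoothSpaceTimeOn (Icc 0 1) (f m) := fun m =>
    ((isSmoothSpaceTimeOn_nsBodyForce_drift hB (Cheskidov2023.visc m) m).twoHalf
      (Torus.isSmoothSpaceTimeOn_const (Torus.isSmooth_const (0 : ℝ)) univ)).mono (subset_univ _)
  -- the force bounds (1.2)
  have hforce : ∀ α : ℝ≥0, α < 1 →
      (∃ C : ℝ≥0∞, C < ∞ ∧ ∀ m, ∀ t ∈ Icc (0 : ℝ) 1, eBoundedHolderNorm α (f m t) ≤ C) ∧
        ∀ m, ContinuousInHolderOn (Icc 0 1) α (f m) := by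
    intro α hα
    obtain ⟨Cα, hCα, hbound⟩ := exists_forall_eBoundedHolderNorm_nsBodyForce_le hB hK hBσ hBσ' hα
    refine ⟨⟨Cα, hCα, fun m t _ => ?_⟩, fun m => continuousInHolderOn_of_isSmoothSpaceTimeOn zero_lt_one (hf_smooth m) hα⟩
    exact (Torus.eBoundedHolderNorm_twoHalf_zero_right_le α _).trans (hbound m t)
  -- the dissipation (1.3): `ν_m ∫₀¹ ‖∇u^m‖² = ν_m ∫₀¹ ‖∇v^m‖² + ν_m ∫₀¹ ‖∇θ^m‖² ≥ 1/4` eventually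
  have h11 : (1 : ℝ) ∈ Icc (0 : ℝ) 1 := ⟨zero_le_one, le_rfl⟩
  have hcv : ∀ m, ContinuousOn (fun s => Torus.gradNormSq (drift vb m s)) (Icc 0 1) := fun m =>
    ((hvS m).continuousOn_gradNormSq convex_univ uniqueDiffOn_univ).mono (subset_univ _)
  have hcθ : ∀ m, ContinuousOn (fun s => Torus.scalarGradNormSq (θ m s)) (Icc 0 1) := fun m =>
    ((hθ m).smooth_scalar.continuousOn_scalarGradNormSq (convex_Icc 0 2) (uniqueDiffOn_Icc zero_lt_two)).mono
      (Icc_subset_Icc le_rfl one_le_two)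
  have hiv : ∀ m, IntervalIntegrable (fun s => Torus.gradNormSq (drift vb m s)) volume 0 1 :=
    fun m => ((hcv m).mono (uIcc_subset_Icc h01 h11)).intervalIntegrable
  have hiθ : ∀ m, IntervalIntegrable (fun s => Torus.scalarGradNormSq (θ m s)) volume 0 1 :=
    fun m => ((hcθ m).mono (uIcc_subset_Icc h01 h11)).intervalIntegrable
  have hsplit : ∀ m, Torus.cumulativeDissipation (Cheskidov2023.visc m) (u m) 0 1 =
      (Cheskidov2023.visc m * ∫ s in (0 : ℝ)..1, Torus.gradNormSq (drift vb m s)) +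
        Cheskidov2023.visc m * ∫ s in (0 : ℝ)..1, Torus.scalarGradNormSq (θ m s) := by
    intro m
    unfold Torus.cumulativeDissipation
    rw [← mul_add, ← intervalIntegral.integral_add (hiv m) (hiθ m)]
    congr 1
    refine intervalIntegral.integral_congr fun s hs => ?_
    have hs' : s ∈ Icc (0 : ℝ) 2 := Icc_subset_Icc le_rfl one_le_two ((uIcc_subset_Icc h01 h11) hs)
    exact Torus.gradNormSq_twoHalf ((hvS m).isSmooth_slice (mem_univ s)) ((hθ m).smooth_scalar.isSmooth_slice hs')
  have hAD : HasAnomalousDissipation Cheskidov2023.visc u := by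
    refine ⟨1 / 4, by norm_num, ?_⟩
    filter_upwards [hev_diss] with m hm
    rw [hsplit m]
    have h0 : 0 ≤ Cheskidov2023.visc m * ∫ s in (0 : ℝ)..1, Torus.gradNormSq (drift vb m s) :=
      mul_nonneg (Cheskidov2023.visc_pos m).le
        (intervalIntegral.integral_nonneg zero_le_one fun s _ => Torus.gradNormSq_nonneg _)
    linarith
  exact ⟨Cheskidov2023.visc, u₀, f, u, p, isVanishingViscosity_visc, hu₀_smooth, hf_smooth,
    fun m => ⟨hNS m, hu0 m⟩, hforce, hAD⟩

/-- **turb.S10 from the Alberti–Crippa–Mazzucato family.** Bruè–De Lellis' anomalous dissipation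
theorem (`brue_deLellis_anomalous_dissipation`, CMP 400 (2023), Thm. 1.1) follows from the single
named fact `alberti_crippa_mazzucato_family` (source, Thm. 4.1 with item (c) per level): the other
input of the printed proof, parabolic well-posedness of the advection–diffusion equation (3.12),
is the proved `Torus.exists_unique_isClassicalScalarTransportForcedOn_holds`, and the velocity
bounds are read off Thm. 4.1 (a) by `Gluing.exists_blockDerivBounds`. [cite: BrueDeLellisCMP2023, Thm. 1.1 and Thm. 4.1] -/
theorem brue_deLellis_anomalous_dissipation_of_acm_family (h : alberti_crippa_mazzucato_family) :
    brue_deLellis_anomalous_dissipation := by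
  obtain ⟨ρ, v, hsol, ha, ha', hb, hC, -, hd⟩ := h
  obtain ⟨A, hK⟩ := Gluing.exists_blockDerivBounds (fun n => (hsol n).smooth_velocity) ha ha'
  exact brue_deLellis_anomalous_dissipation_of_blocks ⟨hsol, hd⟩ hb hC hK
    Torus.exists_unique_isClassicalScalarTransportForcedOn_holds

/-- **Deprecated** (2026-08-16) with its hypothesis, the mis-stated `n`-uniform-support reading of
Thm. 4.1 (c) (`alberti_crippa_mazzucato_quasi_self_similar`, deprecated in `QuasiSelfSimilarMixing.lean`):
use `brue_deLellis_anomalous_dissipation_of_acm_family`. *Content (unchanged):* turb.S10 from that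
reading, through `alberti_crippa_mazzucato_quasi_self_similar.family`. [cite: BrueDeLellisCMP2023, Thm. 1.1 and Thm. 4.1] -/
@[deprecated brue_deLellis_anomalous_dissipation_of_acm_family (since := "2026-08-16")]
theorem brue_deLellis_anomalous_dissipation_of_acm (h : alberti_crippa_mazzucato_quasi_self_similar) :
    brue_deLellis_anomalous_dissipation :=
  brue_deLellis_anomalous_dissipation_of_acm_family h.family

/-- **turb.S10 from the structural building-block fact.** Bruè–De Lellis' Thm. 1.1 follows from
`acm_building_blocks` (finitely many Alberti–Crippa–Mazzucato building blocks patching smoothly with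
handover; ACM 2019, §8, as used in the source, §4.1 and Thm. 4.1) through the scaling analysis
`alberti_crippa_mazzucato_family_of_building_blocks` (`QuasiSelfSimilarFamilyProofs`). [cite: BrueDeLellisCMP2023, Thm. 1.1, §4.1 and Thm. 4.1] -/
theorem brue_deLellis_anomalous_dissipation_of_acm_building_blocks (h : acm_building_blocks) :
    brue_deLellis_anomalous_dissipation :=
  brue_deLellis_anomalous_dissipation_of_acm_family (alberti_crippa_mazzucato_family_of_building_blocks h)

/-- **turb.S10 from the compatible blocks of the Peano snake.** Bruè–De Lellis' Thm. 1.1 follows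
from the kinematic leaf `acm_compatible_blocks` (Alberti–Crippa–Mazzucato 2019, §8.1, §8.4 (a)–(c),
§8.6) through `acm_building_blocks_of_compatible_blocks` (`QuasiSelfSimilarCompatibleBlocksProofs`).
This is the whole remaining debt of `brue_deLellis_anomalous_dissipation`: what is left for
`brue_deLellis_anomalous_dissipation_holds` is exactly `acm_compatible_blocks_holds`. [cite: BrueDeLellisCMP2023, Thm. 1.1 and Thm. 4.1] [cite: AlbertiCrippaMazzucato2019, §8.1, §8.4, §8.6] -/
theorem brue_deLellis_anomalous_dissipation_of_compatible_blocks (h : acm_compatible_blocks) :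
    brue_deLellis_anomalous_dissipation :=
  brue_deLellis_anomalous_dissipation_of_acm_building_blocks (acm_building_blocks_of_compatible_blocks h)

end Literature.Analysis.FluidPDE

end
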